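import Literature.Probability.LatticeModels.LatticeGreenFunction
import Mathlib
import HarnessLib

/-!
# Stub `stub_profile` of line `Sketch` (crux `stmt-QuantumFields-8760`)

Route `EquipartitionCriticality` of `YangMills`, crux item `stmt-QuantumFields-8760`
(`Summit.QuantumFields.YangMills.Theses.EquipartitionCriticality.EquipartitionPinsProbe`), line
`Sketch`, STUB 6 of the lead's skeleton.

What is proved: positivity, boundedness and a sub-exponential lower bound for the
Källén–Lehmann integral
`J_n = ∫_{[-π,π]³} w(k) r(k)ⁿ dk`, `w(k) = √(ε(k)/(ε(k)+2))`, `r(k) = 1 + ε(k) - √(ε(k)(ε(k)+2))`,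
`ε = dispersion` on `Fin 3 → ℝ` and `[-π,π]³ = brillouin 3`:

* `0 < J_n ≤ (2π)³` for every `n : ℕ`;
* for every `ε₀ > 0` there is `C > 0` with `C e^{-ε₀ n} ≤ J_n` for all `n`.

How: elementary real inequalities give `0 ≤ w ≤ 1` and `0 < r ≤ 1` pointwise (`Profile.weight_le_one`,
`Profile.ratio_pos`, `Profile.ratio_le_one`), whence the integrand lies in `[0,1]` and
`J_n ≤ volume([-π,π]³) = (2π)³` (`Profile.setIntegral_brillouin_le`, via
`MeasureTheory.norm_setIntegral_le_of_norm_le_const` and `MeasureTheory.volume_pi_pi`). For the lower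
bound (`Profile.exists_exp_mul_le_setIntegral`, stated for abstract continuous `w, r` with `w ≥ 0`,
`w > 0` off the origin of the zone, `r ≥ 0`, `r 0 = 1`): continuity of `r` at `0` gives a `δ > 0`
with `r > e^{-ε₀}` on the sup-ball of radius `δ`; on the compact cube `Q = [δ'/2, δ']³`,
`δ' = min (δ/2) π`, which lies in the zone, avoids the origin and has volume `(δ'/2)³`, the continuous
`w` attains a positive minimum `w₀` (`IsCompact.exists_isMinOn`), so
`J_n ≥ ∫_Q w rⁿ ≥ w₀ (δ'/2)³ e^{-ε₀ n}` (`MeasureTheory.setIntegral_mono_set`,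
`MeasureTheory.setIntegral_mono_on`, `MeasureTheory.setIntegral_const`). Positivity of `J_n` is the
case `ε₀ = 1`. Only proved tree facts (`continuous_dispersion`, `dispersion_nonneg`,
`dispersion_pos_of_mem_brillouin`, `isCompact_brillouin`) and Mathlib are used.
-/

noncomputable section

open MeasureTheory Filter Topology
open Literature.Probability.LatticeModels

namespace Summit.QuantumFields.YangMills.Theorems.EquipartitionPinsProbe

namespace Profile

/-! ### Scalar inequalities for the weight `√(x/(x+2))` and the ratio `1 + x - √(x(x+2))` -/

/-- `1 + x - √(x(x+2)) > 0` for `x ≥ 0`, since `x(x+2) < (1+x)²`. -/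
theorem ratio_pos {x : ℝ} (hx : 0 ≤ x) : 0 < 1 + x - Real.sqrt (x * (x + 2)) := by
  have h : Real.sqrt (x * (x + 2)) < 1 + x := by
    rw [Real.sqrt_lt' (by linarith)]
    nlinarith
  linarith

/-- `1 + x - √(x(x+2)) ≤ 1` for `x ≥ 0`, since `x² ≤ x(x+2)`. -/
theorem ratio_le_one {x : ℝ} (hx : 0 ≤ x) : 1 + x - Real.sqrt (x * (x + 2)) ≤ 1 := by
  have h : x ≤ Real.sqrt (x * (x + 2)) := by
    rw [Real.le_sqrt hx (by positivity)]
    nlinarith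
  linarith

/-- `√(x/(x+2)) ≤ 1` for `x ≥ 0`. -/
theorem weight_le_one {x : ℝ} (hx : 0 ≤ x) : Real.sqrt (x / (x + 2)) ≤ 1 := by
  rw [Real.sqrt_le_one, div_le_one (by linarith)]
  linarith

/-- `√(x/(x+2)) > 0` for `x > 0`. -/
theorem weight_pos {x : ℝ} (hx : 0 < x) : 0 < Real.sqrt (x / (x + 2)) :=
  Real.sqrt_pos.2 (div_pos hx (by linarith))

/-! ### Continuity of the two factors of the integrand -/

/-- The Källén–Lehmann weight `k ↦ √(ε(k)/(ε(k)+2))` is continuous on momentum space. -/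
theorem continuous_weight :
    Continuous fun k : Fin 3 → ℝ => Real.sqrt (dispersion k / (dispersion k + 2)) := by
  have hd := continuous_dispersion 3
  exact Real.continuous_sqrt.comp
    (hd.div (hd.add continuous_const) fun k => by have := dispersion_nonneg k; positivity)

/-- The transfer ratio `k ↦ 1 + ε(k) - √(ε(k)(ε(k)+2))` is continuous on momentum space. -/
theorem continuous_ratio :
    Continuous fun k : Fin 3 → ℝ =>
      1 + dispersion k - Real.sqrt (dispersion k * (dispersion k + 2)) := by
  have hd := continuous_dispersion 3
  exact (continuous_const.add hd).sub (Real.continuous_sqrt.comp (hd.mul (hd.add continuous_const)))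

/-! ### The volume of the Brillouin zone and the upper bound -/

/-- `volume ([-π,π]³) = (2π)³` (as an extended nonnegative real). -/
theorem volume_brillouin_three :
    volume (brillouin 3) = ENNReal.ofReal (2 * Real.pi) ^ 3 := by
  rw [brillouin, volume_pi_pi]
  simp only [Real.volume_Icc, Finset.prod_const, Finset.card_univ, Fintype.card_fin,
    sub_neg_eq_add, ← two_mul]

/-- `volume ([-π,π]³) = (2π)³` (as a real number). -/
theorem volume_real_brillouin_three : volume.real (brillouin 3) = (2 * Real.pi) ^ 3 := by
  rw [measureReal_def, volume_brillouin_three, ENNReal.toReal_pow,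
    ENNReal.toReal_ofReal (by positivity)]

/-- An integral over `[-π,π]³` of a function with values in `[0,1]` is at most `(2π)³`. -/
theorem setIntegral_brillouin_le {f : (Fin 3 → ℝ) → ℝ} (h0 : ∀ k, 0 ≤ f k) (h1 : ∀ k, f k ≤ 1) :
    ∫ k in brillouin 3, f k ≤ (2 * Real.pi) ^ 3 := by
  have h := norm_setIntegral_le_of_norm_le_const (μ := volume) (f := f) (C := 1)
    (isCompact_brillouin 3).measure_lt_top
    (fun k _ => by rw [Real.norm_eq_abs, abs_le]; exact ⟨by linarith [h0 k], h1 k⟩)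
  rw [volume_real_brillouin_three, one_mul] at h
  exact (Real.le_norm_self _).trans h

/-! ### The sub-exponential lower bound -/

/-- **Sub-exponential lower bound.** Let `w, r` be continuous on momentum space `Fin 3 → ℝ` with
`w ≥ 0`, `w > 0` on the Brillouin zone off the origin, `r ≥ 0` and `r 0 = 1`. Then for every
`ε > 0` there is `C > 0` with `C e^{-ε n} ≤ ∫_{[-π,π]³} w rⁿ` for all `n : ℕ`: restrict the integral
to a small cube next to the origin on which `r ≥ e^{-ε}` and `w` is bounded below by a positive
minimum. -/
theorem exists_exp_mul_le_setIntegral {w r : (Fin 3 → ℝ) → ℝ} (hwc : Continuous w)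
    (hrc : Continuous r) (hw0 : ∀ k, 0 ≤ w k) (hwpos : ∀ k ∈ brillouin 3, k ≠ 0 → 0 < w k)
    (hr0 : ∀ k, 0 ≤ r k) (hr1 : r 0 = 1) {ε : ℝ} (hε : 0 < ε) :
    ∃ C : ℝ, 0 < C ∧ ∀ n : ℕ, C * Real.exp (-(ε * n)) ≤ ∫ k in brillouin 3, w k * r k ^ n := by
  -- Step 1: a sup-ball around `0` on which `exp (-ε) < r`.
  have hev : ∀ᶠ k in 𝓝 (0 : Fin 3 → ℝ), Real.exp (-ε) < r k := by
    have h1 : Real.exp (-ε) < r 0 := by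
      rw [hr1]
      exact Real.exp_lt_one_iff.2 (by linarith)
    exact Filter.Tendsto.eventually hrc.continuousAt (lt_mem_nhds h1)
  obtain ⟨δ, hδ, hball⟩ := Metric.eventually_nhds_iff.1 hev
  -- Step 2: the cube `Q = [δ'/2, δ']³` with `0 < δ' < δ`, `δ' ≤ π`.
  obtain ⟨δ', hδ'pos, hδ'δ, hδ'π⟩ : ∃ δ' : ℝ, 0 < δ' ∧ δ' < δ ∧ δ' ≤ Real.pi :=
    ⟨min (δ / 2) Real.pi, lt_min (half_pos hδ) Real.pi_pos,
      (min_le_left _ _).trans_lt (half_lt_self hδ), min_le_right _ _⟩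
  obtain ⟨Q, hQ⟩ : ∃ Q : Set (Fin 3 → ℝ), Q = Set.pi Set.univ fun _ => Set.Icc (δ' / 2) δ' :=
    ⟨_, rfl⟩
  have hQmeas : MeasurableSet Q := hQ ▸ MeasurableSet.univ_pi fun _ => measurableSet_Icc
  have hQcpt : IsCompact Q := hQ ▸ isCompact_univ_pi fun _ => isCompact_Icc
  have hQmem : ∀ k ∈ Q, ∀ i, δ' / 2 ≤ k i ∧ k i ≤ δ' := fun k hk i => by
    rw [hQ] at hk
    exact Set.mem_univ_pi.1 hk i
  have hQne : Q.Nonempty := ⟨fun _ => δ', hQ ▸ Set.mem_univ_pi.2 fun _ => ⟨by linarith, le_rfl⟩⟩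
  have hQsub : Q ⊆ brillouin 3 := fun k hk => Set.mem_univ_pi.2 fun i =>
    ⟨by linarith [(hQmem k hk i).1, Real.pi_pos], (hQmem k hk i).2.trans hδ'π⟩
  have hQne0 : ∀ k ∈ Q, k ≠ 0 := fun k hk h0 => by
    have h := (hQmem k hk 0).1
    rw [h0, Pi.zero_apply] at h
    linarith
  have hQr : ∀ k ∈ Q, Real.exp (-ε) < r k := fun k hk => by
    refine hball ?_
    rw [dist_zero_right, pi_norm_lt_iff hδ]
    intro i
    rw [Real.norm_eq_abs, abs_lt]
    exact ⟨by linarith [(hQmem k hk i).1], by linarith [(hQmem k hk i).2]⟩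
  -- Step 3: the positive minimum of `w` on `Q`.
  obtain ⟨k₀, hk₀, hmin⟩ := hQcpt.exists_isMinOn hQne hwc.continuousOn
  have hw₀ : 0 < w k₀ := hwpos k₀ (hQsub hk₀) (hQne0 k₀ hk₀)
  -- Step 4: the volume of `Q`.
  have hvolQ : volume.real Q = (δ' / 2) ^ 3 := by
    rw [measureReal_def, hQ, volume_pi_pi]
    simp only [Real.volume_Icc, Finset.prod_const, Finset.card_univ, Fintype.card_fin,
      ENNReal.toReal_pow]
    rw [ENNReal.toReal_ofReal (by linarith)]
    ring
  -- Step 5: the bound `J_n ≥ ∫_Q w rⁿ ≥ w₀ e^{-ε n} (δ'/2)³`.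
  refine ⟨w k₀ * (δ' / 2) ^ 3, by positivity, fun n => ?_⟩
  have hint : IntegrableOn (fun k => w k * r k ^ n) (brillouin 3) volume :=
    (hwc.mul (hrc.pow n)).continuousOn.integrableOn_compact (isCompact_brillouin 3)
  have hexp : Real.exp (-(ε * n)) = Real.exp (-ε) ^ n := by
    rw [← Real.exp_nat_mul]
    congr 1
    ring
  calc w k₀ * (δ' / 2) ^ 3 * Real.exp (-(ε * n))
      = ∫ _ in Q, w k₀ * Real.exp (-ε) ^ n := by
        rw [setIntegral_const, hvolQ, smul_eq_mul, hexp]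
        ring
    _ ≤ ∫ k in Q, w k * r k ^ n := by
        refine setIntegral_mono_on (integrableOn_const hQcpt.measure_lt_top.ne)
          (hint.mono_set hQsub) hQmeas fun k hk => ?_
        exact mul_le_mul ((isMinOn_iff.1 hmin) k hk)
          (pow_le_pow_left₀ (Real.exp_pos _).le (hQr k hk).le n)
          (pow_nonneg (Real.exp_pos _).le n) (hw0 k)
    _ ≤ ∫ k in brillouin 3, w k * r k ^ n :=
        setIntegral_mono_set hint
          (Filter.Eventually.of_forall fun k => mul_nonneg (hw0 k) (pow_nonneg (hr0 k) n))
          (Filter.Eventually.of_forall hQsub)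

end Profile

/-- **STUB 6 of line `Sketch`** (crux `stmt-QuantumFields-8760`): positivity, boundedness and
sub-exponential decay of the Källén–Lehmann integral
`J_n = ∫_{[-π,π]³} w(k) r(k)ⁿ dk`, `w = √(ε/(ε+2))`, `r = 1 + ε - √(ε(ε+2))`, `ε = dispersion`:
`0 < J_n ≤ (2π)³` for every `n`, and for every `ε₀ > 0` there is `C > 0` with `C e^{-ε₀ n} ≤ J_n`
for all `n`. -/
theorem stub_profile :
    (∀ n : ℕ,
      0 < ∫ k in Literature.Probability.LatticeModels.brillouin 3,
          Real.sqrt (Literature.Probability.LatticeModels.dispersion k /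
              (Literature.Probability.LatticeModels.dispersion k + 2)) *
            (1 + Literature.Probability.LatticeModels.dispersion k -
              Real.sqrt (Literature.Probability.LatticeModels.dispersion k *
                (Literature.Probability.LatticeModels.dispersion k + 2))) ^ n ∧
      (∫ k in Literature.Probability.LatticeModels.brillouin 3,
          Real.sqrt (Literature.Probability.LatticeModels.dispersion k /
              (Literature.Probability.LatticeModels.dispersion k + 2)) *
            (1 + Literature.Probability.LatticeModels.dispersion k -
              Real.sqrt (Literature.Probability.LatticeModels.dispersion k *
                (Literature.Probability.LatticeModels.dispersion k + 2))) ^ n) ≤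
        (2 * Real.pi) ^ 3) ∧
    (∀ ε : ℝ, 0 < ε → ∃ C : ℝ, 0 < C ∧ ∀ n : ℕ,
      C * Real.exp (-(ε * n)) ≤
        ∫ k in Literature.Probability.LatticeModels.brillouin 3,
          Real.sqrt (Literature.Probability.LatticeModels.dispersion k /
              (Literature.Probability.LatticeModels.dispersion k + 2)) *
            (1 + Literature.Probability.LatticeModels.dispersion k -
              Real.sqrt (Literature.Probability.LatticeModels.dispersion k *
                (Literature.Probability.LatticeModels.dispersion k + 2))) ^ n) := by
  have hw0 : ∀ k : Fin 3 → ℝ, 0 ≤ Real.sqrt (dispersion k / (dispersion k + 2)) := fun k =>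
    Real.sqrt_nonneg _
  have hr0 : ∀ k : Fin 3 → ℝ,
      0 ≤ 1 + dispersion k - Real.sqrt (dispersion k * (dispersion k + 2)) := fun k =>
    (Profile.ratio_pos (dispersion_nonneg k)).le
  have main : ∀ ε : ℝ, 0 < ε → ∃ C : ℝ, 0 < C ∧ ∀ n : ℕ,
      C * Real.exp (-(ε * n)) ≤
        ∫ k in brillouin 3, Real.sqrt (dispersion k / (dispersion k + 2)) *
          (1 + dispersion k - Real.sqrt (dispersion k * (dispersion k + 2))) ^ n :=
    fun ε hε => Profile.exists_exp_mul_le_setIntegral Profile.continuous_weight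
      Profile.continuous_ratio hw0
      (fun k hk hk0 => Profile.weight_pos (dispersion_pos_of_mem_brillouin hk hk0)) hr0
      (by simp [dispersion]) hε
  refine ⟨fun n => ⟨?_, ?_⟩, main⟩
  · obtain ⟨C, hC, h⟩ := main 1 one_pos
    exact lt_of_lt_of_le (mul_pos hC (Real.exp_pos _)) (h n)
  · exact Profile.setIntegral_brillouin_le (fun k => mul_nonneg (hw0 k) (pow_nonneg (hr0 k) n))
      fun k => mul_le_one₀ (Profile.weight_le_one (dispersion_nonneg k)) (pow_nonneg (hr0 k) n)
        (pow_le_one₀ (hr0 k) (Profile.ratio_le_one (dispersion_nonneg k)))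

end Summit.QuantumFields.YangMills.Theorems.EquipartitionPinsProbe
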